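import Literature.NumberTheory.Transcendental.NesterenkoEliminationFacts2
import Literature.NumberTheory.Transcendental.NesterenkoCoeffNorms
import Mathlib.NumberTheory.Height.MvPolynomial
import Mathlib.NumberTheory.Height.NumberField
import Mathlib.RingTheory.MvPolynomial.Tower
import Mathlib.Analysis.Complex.Exponential
import HarnessLib

/-!
# Proof of LNM 1752 Ch. 3 Proposition 4.8 (`K = ℚ`)

Topic `Literature/NumberTheory/Transcendental`. Discharge of the named fact
`NesterenkoPhilippon2001_ch3_prop_4_8` of `NesterenkoEliminationFacts2.lean`: for a principal
ideal `I = (P)`, `P ∈ ℚ[x₀, …, x_m]` homogeneous of degree `d`, and `ω̄ ∈ ℂ^{m+1} ∖ 0`,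
1) `deg I = d`; 2) `h(I) ≤ h(P) + m² d`; 3) `|I(ω̄)| ≤ ‖P‖_ω̄ · e^{2m² d}`.

The book prints no proof (it refers to [Nes10, Prop. 1.3]); the proof formalised here is the
classical one. By `NesterenkoChowFormHypersurface.lean` the associated form of `(P)` is
`c · F`, `F = P(Δ_0, …, Δ_m)`, `c ∈ ℚˣ`, where `Δ_j` are the signed maximal minors of the
generic `m × (m+1)` matrix `U`; all three invariants are insensitive to `c`.
1) `F` is homogeneous of degree `d` in the row `u_1` and `F ≠ 0` (`NesterenkoCoeffNorms.lean`).
2) The coefficients of `F` are `ℤ`-linear combinations of those of `P`, with integer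
   coefficients bounded by `(m!)^d` (each `Δ_j` has `m!` terms `±1`); Mathlib's
   `Height.logHeight_linearMap_apply_le` then gives `h(F) ≤ log #supp P + d log m! + h(P)`,
   and `#supp P ≤ (m+1)^d`, `(m+1)! ≤ 2^{m²}`.
3) The rows `S^{(i)} ω̄` substituted for `u_i` in `ϰ` are orthogonal to `ω̄` (skew-symmetry), so
   `ϰ(Δ_j) = λ ω_j` for one polynomial `λ`, and `ϰ(F) = λ^d P(ω̄)`; hence
   `|I(ω̄)| = |P(ω̄)| · |λ^d| / (|F| |ω̄|^{md})`, and `‖P‖_ω̄ = |P(ω̄)| / (|P| |ω̄|^d)`. The bounds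
   `|λ^d| ≤ (m! (m+1)^m)^d |ω̄|^{(m−1)d}` (determinant expansion) and
   `|P| ≤ (m+1)^{md} |F|` (specialisation `U ↦ U(t)`) leave the constant
   `(m! (m+1)^m (m+1)^m)^d ≤ 4^{m² d} ≤ e^{2 m² d}`.

## References

* [NesterenkoPhilippon2001] LNM 1752 (2001), Ch. 3 §4 Prop. 4.8 (p. 40; PDF p. 52).
* [Nes10] Yu. V. Nesterenko, Proc. Steklov Inst. Math. 218 (1997) 294–331, Prop. 1.3.
-/

noncomputable section

open MvPolynomial Matrix Height

namespace Literature.NumberTheory.Transcendental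

namespace Nesterenko

variable {m : ℕ}

/-! ### Preliminaries: `d ≥ 1`, invariance under the unit `c` -/

/-- A proper principal ideal generated by a homogeneous polynomial has positive degree.
[folklore] -/
theorem pos_of_span_ne_top {P : Rx m} {d : ℕ} (hP0 : P ≠ 0) (hP : P.IsHomogeneous d)
    (h : Ideal.span {P} ≠ ⊤) : 0 < d := by
  by_contra hd
  have hd0 : d = 0 := by omega
  subst hd0
  have htot : P.totalDegree = 0 := le_antisymm hP.totalDegree_le (Nat.zero_le _)
  rw [totalDegree_eq_zero_iff_eq_C] at htot
  refine h (Ideal.span_singleton_eq_top.mpr ?_)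
  rw [htot]
  refine (isUnit_iff_ne_zero.mpr ?_).map C
  intro h0
  exact hP0 (by rw [htot, h0, C_0])

/-- `deg_{u_i}` ignores non-zero constant factors. [folklore] -/
theorem blockDeg_C_mul {r : ℕ} {c : ℚ} (hc : c ≠ 0) (F : RU r m) (i : Fin r) :
    blockDeg (C c * F) i = blockDeg F i := by
  rw [blockDeg, blockDeg, C_mul', support_smul_eq hc]

/-- `h(λ F) = h(F)` for `λ ≠ 0` (product formula). [cite: NesterenkoPhilippon2001, Ch. 3 §4
(p. 38)] -/
theorem height_C_mul {σ : Type*} {c : ℚ} (hc : c ≠ 0) (F : MvPolynomial σ ℚ) :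
    height (C c * F) = height F := by
  have hsupp : (C c * F).support = F.support := by rw [C_mul', support_smul_eq hc]
  let e : {x // x ∈ (C c * F).support} ≃ {x // x ∈ F.support} :=
    Equiv.subtypeEquivRight fun x => by rw [hsupp]
  have h1 : (fun γ : {x // x ∈ (C c * F).support} => (C c * F).coeff γ) =
      c • ((fun γ : {x // x ∈ F.support} => F.coeff γ) ∘ e) := by
    funext γ
    simp [e, coeff_C_mul]
  rw [height, height, h1, logHeight_smul_eq_logHeight _ hc, logHeight_comp_equiv]

/-- `|λ F| = |λ| |F|`-invariance of `maxNorm` ratios: the rational constant. [folklore] -/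
theorem norm_ratCast_eq (c : ℚ) : ‖(c : ℂ)‖ = ‖c‖ := by
  rw [Complex.norm_ratCast, ← Real.norm_eq_abs, Rat.norm_cast_real]

/-! ### Part 1: the degree -/

/-- **Prop. 4.8 1)**: `deg (P) = deg P`. [cite: NesterenkoPhilippon2001, Ch. 3 Prop. 4.8 1)
(p. 40)] -/
theorem ideg_span_singleton {P : Rx m} {d : ℕ} (hm : 1 ≤ m) (hP0 : P ≠ 0)
    (hP : P.IsHomogeneous d) (hd : 0 < d) : ideg (Ideal.span {P}) m = d := by
  obtain ⟨c, hc, hcf⟩ := chowForm_span_singleton hP hd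
  rw [ideg, dif_pos (by omega : 0 < m), hcf, blockDeg_C_mul hc,
    blockDeg_hyperChow hP (hyperChow_ne_zero hP hP0)]

/-! ### Part 2: the height -/

/-- `‖Δ_j‖₁ ≤ m!` (a determinant of `m × m` variables). [folklore] -/
theorem l1Norm_genDelta_le (j : Fin (m + 1)) : l1Norm (genDelta m j) ≤ (m.factorial : ℝ) := by
  rw [genDelta, maxMinor]
  have hsign : ((-1 : RU m m) ^ (j : ℕ)) = C ((-1) ^ (j : ℕ)) := by simp
  rw [hsign]
  refine (l1Norm_C_mul_le _ _).trans ?_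
  rw [norm_pow, norm_neg, norm_one, one_pow, one_mul]
  refine (l1Norm_det_le _ (B := 1) fun i k => ?_).trans (by simp)
  simp [mvPolynomialX, l1Norm_X]

/-- The monomial `Δ^γ = ∏_j Δ_j^{γ_j}`. [folklore] -/
def deltaMonomial (m : ℕ) (γ : Fin (m + 1) →₀ ℕ) : RU m m :=
  γ.prod fun j k => genDelta m j ^ k

/-- `‖Δ^γ‖₁ ≤ (m!)^{|γ|}`. [folklore] -/
theorem l1Norm_deltaMonomial_le (γ : Fin (m + 1) →₀ ℕ) :
    l1Norm (deltaMonomial m γ) ≤ (m.factorial : ℝ) ^ γ.degree := by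
  rw [deltaMonomial, Finsupp.prod, Finsupp.degree_apply, ← Finset.prod_pow_eq_pow_sum]
  refine (l1Norm_prod_le _ _).trans (Finset.prod_le_prod (fun _ _ => l1Norm_nonneg _) ?_)
  intro j _
  exact (l1Norm_pow_le _ _).trans
    (pow_le_pow_left₀ (l1Norm_nonneg _) (l1Norm_genDelta_le j) _)

/-- The signed maximal minors of the generic matrix with integer coefficients. [folklore] -/
def genDeltaInt (m : ℕ) (j : Fin (m + 1)) : MvPolynomial (Fin m × Fin (m + 1)) ℤ :=
  maxMinor (mvPolynomialX (Fin m) (Fin (m + 1)) ℤ) j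

/-- `Δ_j` has integer coefficients. [folklore] -/
theorem map_genDeltaInt (j : Fin (m + 1)) :
    map (Int.castRingHom ℚ) (genDeltaInt m j) = genDelta m j := by
  rw [genDeltaInt, map_maxMinor, genDelta]
  congr 1
  ext i k
  simp [mvPolynomialX]

/-- `Δ^γ` with integer coefficients. [folklore] -/
def deltaMonomialInt (m : ℕ) (γ : Fin (m + 1) →₀ ℕ) : MvPolynomial (Fin m × Fin (m + 1)) ℤ :=
  γ.prod fun j k => genDeltaInt m j ^ k

/-- `Δ^γ` has integer coefficients. [folklore] -/
theorem map_deltaMonomialInt (γ : Fin (m + 1) →₀ ℕ) :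
    map (Int.castRingHom ℚ) (deltaMonomialInt m γ) = deltaMonomial m γ := by
  rw [deltaMonomialInt, Finsupp.prod, map_prod, deltaMonomial, Finsupp.prod]
  refine Finset.prod_congr rfl fun j _ => ?_
  rw [map_pow, map_genDeltaInt]

/-- The coefficients of `Δ^γ` are the integers `(Δ^γ)_β`. [folklore] -/
theorem coeff_deltaMonomial (γ : Fin (m + 1) →₀ ℕ) (β : Fin m × Fin (m + 1) →₀ ℕ) :
    (deltaMonomial m γ).coeff β = (((deltaMonomialInt m γ).coeff β : ℤ) : ℚ) := by
  rw [← map_deltaMonomialInt, coeff_map]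
  rfl

/-- The coefficients of `Δ^γ` are integers of modulus at most `(m!)^{|γ|}`. [folklore] -/
theorem abs_coeff_deltaMonomialInt_le (γ : Fin (m + 1) →₀ ℕ) (β : Fin m × Fin (m + 1) →₀ ℕ) :
    |(deltaMonomialInt m γ).coeff β| ≤ (m.factorial : ℤ) ^ γ.degree := by
  have h := (norm_coeff_le_l1Norm (deltaMonomial m γ) β).trans (l1Norm_deltaMonomial_le γ)
  rw [coeff_deltaMonomial, Int.norm_cast_rat, Int.norm_eq_abs, ← Int.cast_abs] at h
  exact_mod_cast h

/-- `F = P(Δ)` coefficientwise: `F_β = ∑_γ (Δ^γ)_β a_γ`. [folklore] -/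
theorem coeff_hyperChow (P : Rx m) (β : Fin m × Fin (m + 1) →₀ ℕ) :
    (hyperChow P).coeff β =
      ∑ γ ∈ P.support, (((deltaMonomialInt m γ).coeff β : ℤ) : ℚ) * P.coeff γ := by
  have hF : hyperChow P = ∑ γ ∈ P.support, C (P.coeff γ) * deltaMonomial m γ := by
    conv_lhs => rw [hyperChow, P.as_sum, map_sum]
    refine Finset.sum_congr rfl fun γ _ => ?_
    rw [aeval_monomial, ← C_eq_algebraMap, deltaMonomial]
  rw [hF, coeff_sum]
  refine Finset.sum_congr rfl fun γ _ => ?_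
  rw [coeff_C_mul, coeff_deltaMonomial, mul_comm]

/-- **Heights of integer vectors**: a vector of integers of modulus at most `B` (`B ≥ 1`) has
logarithmic height at most `log B` (pull out the gcd, then Mathlib's
`Rat.mulHeight_eq_max_abs_of_gcd_eq_one`). [folklore] -/
theorem logHeight_intCast_le {ι : Type*} [Fintype ι] (z : ι → ℤ) {B : ℕ} (hB : 1 ≤ B)
    (h : ∀ i, |z i| ≤ B) : logHeight (fun i => (z i : ℚ)) ≤ Real.log B := by
  classical
  have hB' : (0 : ℝ) ≤ Real.log B := Real.log_nonneg (by exact_mod_cast hB)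
  rcases isEmpty_or_nonempty ι with hι | hι
  · rwa [logHeight_eq_zero_of_subsingleton]
  by_cases hz : z = 0
  · have : (fun i => (z i : ℚ)) = 0 := by
      funext i
      simp [hz]
    rwa [this, logHeight_zero]
  obtain ⟨z', hz', hgcd⟩ := Finset.extract_gcd z (Finset.univ_nonempty (α := ι))
  have hg0 : Finset.univ.gcd z ≠ 0 := by
    intro h0
    rw [Finset.gcd_eq_zero_iff] at h0
    exact hz (funext fun i => h0 i (Finset.mem_univ i))
  have hfun : (fun i => (z i : ℚ)) = ((Finset.univ.gcd z : ℤ) : ℚ) • (((↑) : ℤ → ℚ) ∘ z') := by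
    funext i
    simp [hz' i (Finset.mem_univ i)]
  have hz'le : ∀ i, |z' i| ≤ B := by
    intro i
    have h2 : |z' i| ≤ |z i| := by
      rw [hz' i (Finset.mem_univ i), abs_mul]
      exact le_mul_of_one_le_left (abs_nonneg _) (Int.one_le_abs hg0)
    exact h2.trans (h i)
  rw [logHeight_eq_log_mulHeight, hfun, mulHeight_smul_eq_mulHeight _ (by exact_mod_cast hg0)]
  refine Real.log_le_log (mulHeight_pos _) ?_
  rw [Rat.mulHeight_eq_max_abs_of_gcd_eq_one hgcd]
  exact_mod_cast ciSup_le hz'le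

/-- `m + 2 ≤ 2^{2m+1}`. [folklore] -/
theorem add_two_le_two_pow : ∀ m : ℕ, m + 2 ≤ 2 ^ (2 * m + 1)
  | 0 => by norm_num
  | m + 1 => by
    have ih := add_two_le_two_pow m
    calc m + 1 + 2 ≤ (m + 2) * 4 := by omega
      _ ≤ 2 ^ (2 * m + 1) * 4 := Nat.mul_le_mul_right 4 ih
      _ = 2 ^ (2 * (m + 1) + 1) := by ring

/-- `(m+1)! ≤ 2^{m²}`. [folklore] -/
theorem factorial_succ_le_two_pow_sq : ∀ m : ℕ, (m + 1).factorial ≤ 2 ^ (m * m)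
  | 0 => by decide
  | m + 1 => by
    rw [Nat.factorial_succ]
    calc (m + 1 + 1) * (m + 1).factorial ≤ 2 ^ (2 * m + 1) * 2 ^ (m * m) :=
          Nat.mul_le_mul (add_two_le_two_pow m) (factorial_succ_le_two_pow_sq m)
      _ = 2 ^ ((m + 1) * (m + 1)) := by rw [← pow_add]; congr 1; ring

/-- `log (m+1) + log m! ≤ m²`. [folklore] -/
theorem log_succ_add_log_factorial_le (m : ℕ) :
    Real.log (m + 1) + Real.log m.factorial ≤ (m : ℝ) ^ 2 := by
  have h1 : Real.log (m + 1) + Real.log m.factorial = Real.log ((m + 1).factorial : ℕ) := by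
    rw [Nat.factorial_succ, Nat.cast_mul,
      Real.log_mul (by positivity) (by exact_mod_cast (Nat.factorial_pos m).ne')]
    push_cast
    ring_nf
  rw [h1]
  have hlog2 : Real.log 2 ≤ 1 := by
    rw [Real.log_le_iff_le_exp (by norm_num)]
    have h := Real.add_one_le_exp 1
    norm_num at h
    exact h
  calc Real.log ((m + 1).factorial : ℕ) ≤ Real.log ((2 : ℝ) ^ (m * m)) :=
        Real.log_le_log (by exact_mod_cast Nat.factorial_pos _)
          (by exact_mod_cast factorial_succ_le_two_pow_sq m)
    _ = (m * m : ℝ) * Real.log 2 := by rw [Real.log_pow]; push_cast; ring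
    _ ≤ (m * m : ℝ) * 1 :=
        mul_le_mul_of_nonneg_left hlog2 (by positivity)
    _ = (m : ℝ) ^ 2 := by ring

/-- **`h(P(Δ)) ≤ h(P) + m² deg P`.** [cite: NesterenkoPhilippon2001, Ch. 3 Prop. 4.8 2)
(p. 40)] -/
theorem height_hyperChow_le {P : Rx m} {d : ℕ} (hP0 : P ≠ 0) (hP : P.IsHomogeneous d) :
    height (hyperChow P) ≤ height P + (m : ℝ) ^ 2 * d := by
  classical
  let A : ↥(hyperChow P).support × ↥P.support → ℚ :=
    fun p => (((deltaMonomialInt m p.2).coeff p.1 : ℤ) : ℚ)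
  let x : ↥P.support → ℚ := fun γ => P.coeff γ
  have hAx : (fun β : ↥(hyperChow P).support => (hyperChow P).coeff β) =
      fun β => ∑ γ, A (β, γ) * x γ := by
    funext β
    rw [coeff_hyperChow]
    exact (Finset.sum_coe_sort P.support
      (fun γ => (((deltaMonomialInt m γ).coeff β : ℤ) : ℚ) * P.coeff γ)).symm
  have h1 := logHeight_linearMap_apply_le A x
  rw [← hAx, NumberField.totalWeight_eq_finrank, Module.finrank_self, Nat.cast_one, one_mul] at h1
  have hcard : (Nat.card ↥P.support : ℝ) ≤ (m + 1 : ℝ) ^ d := by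
    rw [Nat.card_eq_fintype_card, Fintype.card_coe]
    exact_mod_cast card_support_le_pow_of_isHomogeneous hP
  have hcard_pos : (0 : ℝ) < Nat.card ↥P.support := by
    rw [Nat.card_eq_fintype_card, Fintype.card_coe]
    exact_mod_cast Finset.card_pos.mpr (support_nonempty.mpr hP0)
  have hlog1 : Real.log (Nat.card ↥P.support) ≤ d * Real.log (m + 1) := by
    rw [← Real.log_pow]
    exact Real.log_le_log hcard_pos hcard
  have hA : logHeight A ≤ d * Real.log m.factorial := by
    have := logHeight_intCast_le
      (fun p : ↥(hyperChow P).support × ↥P.support => (deltaMonomialInt m p.2).coeff p.1)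
      (B := m.factorial ^ d) (Nat.one_le_pow _ _ (Nat.factorial_pos m)) ?_
    · rw [Nat.cast_pow, Real.log_pow] at this
      exact this
    · rintro ⟨β, γ⟩
      have hdeg : (γ : Fin (m + 1) →₀ ℕ).degree = d := by
        rw [hP.degree_eq_sum_deg_support γ.2]
        rfl
      have := abs_coeff_deltaMonomialInt_le (m := m) γ β
      rw [hdeg] at this
      exact_mod_cast this
  have hx : logHeight x = height P := rfl
  have hfact := log_succ_add_log_factorial_le m
  have hd0 : (0 : ℝ) ≤ d := Nat.cast_nonneg d
  calc height (hyperChow P)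
      = logHeight (fun β : ↥(hyperChow P).support => (hyperChow P).coeff β) := rfl
    _ ≤ Real.log (Nat.card ↥P.support) + logHeight A + logHeight x := h1
    _ ≤ d * Real.log (m + 1) + d * Real.log m.factorial + height P := by
        rw [hx]; gcongr
    _ = height P + d * (Real.log (m + 1) + Real.log m.factorial) := by ring
    _ ≤ height P + d * (m : ℝ) ^ 2 := by gcongr
    _ = height P + (m : ℝ) ^ 2 * d := by ring

/-- **Prop. 4.8 2)**: `h((P)) ≤ h(P) + m² deg P`. [cite: NesterenkoPhilippon2001, Ch. 3
Prop. 4.8 2) (p. 40)] -/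
theorem iheight_span_singleton_le {P : Rx m} {d : ℕ} (hP0 : P ≠ 0) (hP : P.IsHomogeneous d)
    (hd : 0 < d) : iheight (Ideal.span {P}) m ≤ height P + (m : ℝ) ^ 2 * d := by
  obtain ⟨c, hc, hcf⟩ := chowForm_span_singleton hP hd
  rw [iheight, hcf, height_C_mul hc]
  exact height_hyperChow_le hP0 hP

/-! ### Part 3: the absolute value at `ω̄` -/

/-- The matrix `W` of rows `S^{(i)} ω̄` (entries the linear forms `λ_{ij}(ω̄)` of
`NesterenkoEliminationNorms.lean`), so that `ϰ` is the substitution `u_{ij} ↦ W_{ij}`.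
[cite: NesterenkoPhilippon2001, Ch. 3 Def. 4.6 (p. 39)] -/
def Wmat (ω : Fin (m + 1) → ℂ) : Matrix (Fin m) (Fin (m + 1)) (RS m m) :=
  Matrix.of fun i j => lam ω i j

/-- `ϰ` is the substitution `u_{ij} ↦ W_{ij}`. [cite: NesterenkoPhilippon2001, Ch. 3 Def. 4.6
(p. 39)] -/
theorem kappa_eq_aeval (ω : Fin (m + 1) → ℂ) (F : RU m m) :
    kappa ω F = aeval (fun ij : Fin m × Fin (m + 1) => Wmat ω ij.1 ij.2) F := rfl

/-- `ϰ(Δ_j) = Δ_j(W)`. [folklore] -/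
theorem kappa_genDelta (ω : Fin (m + 1) → ℂ) (j : Fin (m + 1)) :
    kappa ω (genDelta m j) = maxMinor (Wmat ω) j := by
  rw [kappa_eq_aeval, genDelta, show (aeval fun ij : Fin m × Fin (m + 1) => Wmat ω ij.1 ij.2)
      (maxMinor (mvPolynomialX (Fin m) (Fin (m + 1)) ℚ) j) =
      (aeval fun ij : Fin m × Fin (m + 1) => Wmat ω ij.1 ij.2).toRingHom
        (maxMinor (mvPolynomialX (Fin m) (Fin (m + 1)) ℚ) j) from rfl, map_maxMinor]
  congr 1
  ext i k
  simp [mvPolynomialX]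

/-- **Skew-symmetry**: the rows `S^{(i)} ω̄` are orthogonal to `ω̄`, `W ω̄ = 0`. [folklore] -/
theorem Wmat_mulVec (ω : Fin (m + 1) → ℂ) : Wmat ω *ᵥ (fun j => C (ω j)) = 0 := by
  funext i
  have h := sum_sum_skewEntry_mul_eq_zero (m := m) i ω 1
  rw [one_smul] at h
  exact h

/-- `Δ_k(W) ω_j = Δ_j(W) ω_k`: the vector `Δ(W)` is proportional to `ω̄`. [folklore] -/
theorem maxMinor_Wmat_mul (ω : Fin (m + 1) → ℂ) (j k : Fin (m + 1)) :
    maxMinor (Wmat ω) k * C (ω j) = maxMinor (Wmat ω) j * C (ω k) :=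
  maxMinor_mul_eq_of_mulVec_eq_zero _ _ (Wmat_mulVec ω) j k

/-- **`ϰ(F) = λ^d · P(ω̄)`** with `λ = Δ_{j₀}(W) / ω_{j₀}` for any `j₀` with `ω_{j₀} ≠ 0`.
[cite: NesterenkoPhilippon2001, Ch. 3 Prop. 4.8 3) (p. 40)] -/
theorem kappa_hyperChow_eq {P : Rx m} {d : ℕ} (hP : P.IsHomogeneous d) {ω : Fin (m + 1) → ℂ}
    (j₀ : Fin (m + 1)) (hj₀ : ω j₀ ≠ 0) :
    kappa ω (hyperChow P) = (maxMinor (Wmat ω) j₀ * C (ω j₀)⁻¹) ^ d * C (aeval ω P) := by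
  have hk : ∀ k, (aeval fun ij : Fin m × Fin (m + 1) => Wmat ω ij.1 ij.2) (genDelta m k) =
      maxMinor (Wmat ω) j₀ * C (ω j₀)⁻¹ * C (ω k) := by
    intro k
    rw [← kappa_eq_aeval, kappa_genDelta]
    calc maxMinor (Wmat ω) k = maxMinor (Wmat ω) k * C (ω j₀) * C (ω j₀)⁻¹ := by
          rw [mul_assoc, ← C_mul, mul_inv_cancel₀ hj₀, C_1, mul_one]
      _ = maxMinor (Wmat ω) j₀ * C (ω k) * C (ω j₀)⁻¹ := by rw [maxMinor_Wmat_mul ω j₀ k]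
      _ = maxMinor (Wmat ω) j₀ * C (ω j₀)⁻¹ * C (ω k) := by ring
  rw [kappa_eq_aeval, hyperChow, map_aeval_eq]
  simp_rw [hk]
  rw [aeval_mul_of_isHomogeneous hP]
  congr 1
  have : (fun i => C (ω i) : Fin (m + 1) → RS m m) = algebraMap ℂ (RS m m) ∘ ω := by
    funext i
    simp [algebraMap_eq]
  rw [this, aeval_algebraMap_apply, algebraMap_eq]

/-- `‖Δ_j(W)‖₁ ≤ m! ((m+1) |ω̄|)^m`. [folklore] -/
theorem l1Norm_maxMinor_Wmat_le (ω : Fin (m + 1) → ℂ) (j : Fin (m + 1)) :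
    l1Norm (maxMinor (Wmat ω) j) ≤ m.factorial * ((m + 1) ^ m * ‖ω‖ ^ m) := by
  rw [maxMinor]
  have hsign : ((-1 : RS m m) ^ (j : ℕ)) = C ((-1) ^ (j : ℕ)) := by simp
  rw [hsign]
  refine (l1Norm_C_mul_le _ _).trans ?_
  rw [norm_pow, norm_neg, norm_one, one_pow, one_mul]
  refine (l1Norm_det_le _ (B := (m + 1) * ‖ω‖) fun a b => ?_).trans (by simp [mul_pow])
  exact l1Norm_lam_le ω a _

/-- `(m+1)^3 ≤ 4^m` for `m ≥ 3`. [folklore] -/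
theorem succ_pow_three_le_four_pow (m : ℕ) (hm : 3 ≤ m) : (m + 1) ^ 3 ≤ 4 ^ m := by
  induction m, hm using Nat.le_induction with
  | base => decide
  | succ m hm ih =>
    have key : (m + 1 + 1) ^ 3 + (3 * m ^ 3 + 6 * m ^ 2) = 4 * (m + 1) ^ 3 + 4 := by ring
    have h3 : 1 ≤ m ^ 3 := Nat.one_le_pow 3 m (by omega)
    have h2 : 1 ≤ m ^ 2 := Nat.one_le_pow 2 m (by omega)
    calc (m + 1 + 1) ^ 3 ≤ 4 * (m + 1) ^ 3 := by linarith
      _ ≤ 4 * 4 ^ m := by omega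
      _ = 4 ^ (m + 1) := by ring

/-- **The constant of Prop. 4.8 3)**: `m! · (m+1)^m · (m+1)^m ≤ 4^{m²}`. [folklore] -/
theorem factorial_mul_pow_mul_pow_le (m : ℕ) :
    m.factorial * (m + 1) ^ m * (m + 1) ^ m ≤ 4 ^ (m * m) := by
  rcases (show m ≤ 2 ∨ 3 ≤ m by omega) with h | h
  · interval_cases m <;> decide
  · calc m.factorial * (m + 1) ^ m * (m + 1) ^ m ≤ m ^ m * (m + 1) ^ m * (m + 1) ^ m := by
          gcongr; exact Nat.factorial_le_pow m
      _ ≤ (m + 1) ^ m * (m + 1) ^ m * (m + 1) ^ m := by gcongr; omega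
      _ = (m + 1) ^ (3 * m) := by rw [← pow_add, ← pow_add]; congr 1; ring
      _ = ((m + 1) ^ 3) ^ m := pow_mul (m + 1) 3 m
      _ ≤ (4 ^ m) ^ m := Nat.pow_le_pow_left (succ_pow_three_le_four_pow m h) m
      _ = 4 ^ (m * m) := by rw [← pow_mul]

/-- `(m! (m+1)^m (m+1)^m)^d ≤ e^{2 m² d}`. [folklore] -/
theorem const_pow_le_exp (m d : ℕ) :
    ((m.factorial : ℝ) * (m + 1) ^ m * (m + 1) ^ m) ^ d ≤ Real.exp (2 * (m : ℝ) ^ 2 * d) := by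
  have h4 : (4 : ℝ) ≤ Real.exp 2 := by
    have h := Real.add_one_le_exp 1
    calc (4 : ℝ) = (1 + 1) * (1 + 1) := by norm_num
      _ ≤ Real.exp 1 * Real.exp 1 := mul_le_mul h h (by norm_num) ((by norm_num : (0:ℝ) ≤ 1 + 1).trans h)
      _ = Real.exp 2 := by rw [← Real.exp_add]; norm_num
  calc ((m.factorial : ℝ) * (m + 1) ^ m * (m + 1) ^ m) ^ d ≤ ((4 : ℝ) ^ (m * m)) ^ d := by
        gcongr
        exact_mod_cast factorial_mul_pow_mul_pow_le m
    _ = 4 ^ (m * m * d) := by rw [← pow_mul]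
    _ ≤ Real.exp 2 ^ (m * m * d) := pow_le_pow_left₀ (by norm_num) h4 _
    _ = Real.exp (2 * (m : ℝ) ^ 2 * d) := by
        rw [← Real.exp_nat_mul]
        congr 1
        push_cast
        ring

/-- **Prop. 4.8 3)**: `|(P)(ω̄)| ≤ ‖P‖_ω̄ e^{2 m² deg P}`. [cite: NesterenkoPhilippon2001, Ch. 3
Prop. 4.8 3) (p. 40)] -/
theorem iabs_span_singleton_le {P : Rx m} {d : ℕ} (hm : 1 ≤ m) (hP0 : P ≠ 0)
    (hP : P.IsHomogeneous d) (hd : 0 < d) {ω : Fin (m + 1) → ℂ} (hω : ω ≠ 0) :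
    iabs (Ideal.span {P}) m ω ≤ normAt ω P * Real.exp (2 * (m : ℝ) ^ 2 * d) := by
  classical
  obtain ⟨c, hc, hcf⟩ := chowForm_span_singleton hP hd
  have hF0 : hyperChow P ≠ 0 := hyperChow_ne_zero hP hP0
  -- a coordinate of maximal modulus
  obtain ⟨j₀, hj₀⟩ := exists_norm_apply_eq_norm ω
  have hnorm : ‖ω‖ = ‖ω j₀‖ := hj₀.symm
  have hωpos : 0 < ‖ω‖ := norm_pos_iff.mpr hω
  have hωj₀ : ω j₀ ≠ 0 := by
    rw [← norm_pos_iff, ← hnorm]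
    exact hωpos
  -- `|I(ω̄)|` in terms of `F`
  have hideg : ideg (Ideal.span {P}) m = d := ideg_span_singleton hm hP0 hP hd
  have hkC : kappa ω (C c * hyperChow P) = C (c : ℂ) * kappa ω (hyperChow P) := by
    rw [kappa_eq_aeval, map_mul, ← kappa_eq_aeval, ← kappa_eq_aeval, kappa_C]
  have hiabs : iabs (Ideal.span {P}) m ω =
      maxNorm (kappa ω (hyperChow P)) / (maxNorm (hyperChow P) * ‖ω‖ ^ (m * d)) := by
    rw [iabs, hideg, hcf, hkC, maxNorm_C_mul, maxNorm_C_mul, norm_ratCast_eq, mul_assoc,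
      mul_div_mul_left _ _ (norm_ne_zero_iff.mpr hc)]
  -- `ϰ(F) = λ^d P(ω̄)`
  have hkF := kappa_hyperChow_eq hP j₀ hωj₀
  have hX : maxNorm (kappa ω (hyperChow P)) =
      ‖aeval ω P‖ * maxNorm ((maxMinor (Wmat ω) j₀ * C (ω j₀)⁻¹) ^ d) := by
    rw [hkF, mul_comm, maxNorm_C_mul]
  -- `|λ^d| ≤ (m! (m|ω̄|)^m)^d / |ω̄|^d`
  have hlamd : maxNorm ((maxMinor (Wmat ω) j₀ * C (ω j₀)⁻¹) ^ d) ≤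
      ((m.factorial : ℝ) * ((m + 1) ^ m * ‖ω‖ ^ m)) ^ d / ‖ω‖ ^ d := by
    rw [mul_pow, ← C_pow, mul_comm, maxNorm_C_mul, norm_pow, norm_inv, ← hnorm, inv_pow,
      ← div_eq_inv_mul]
    refine div_le_div_of_nonneg_right ?_ (pow_nonneg (norm_nonneg _) _)
    exact (maxNorm_le_l1Norm _).trans ((l1Norm_pow_le _ _).trans
      (pow_le_pow_left₀ (l1Norm_nonneg _) (l1Norm_maxMinor_Wmat_le ω j₀) _))
  -- `|P| ≤ (m+1)^{md} |F|`
  have hPF : maxNorm P ≤ (m + 1 : ℝ) ^ (m * d) * maxNorm (hyperChow P) :=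
    (maxNorm_le_card_mul_maxNorm_hyperChow hP).trans
      (mul_le_mul_of_nonneg_right (by exact_mod_cast card_support_hyperChow_le hP)
        (maxNorm_nonneg _))
  have hFpos : 0 < maxNorm (hyperChow P) := maxNorm_pos hF0
  have hPpos : 0 < maxNorm P := maxNorm_pos hP0
  have key : maxNorm ((maxMinor (Wmat ω) j₀ * C (ω j₀)⁻¹) ^ d) * (maxNorm P * ‖ω‖ ^ d) ≤
      Real.exp (2 * (m : ℝ) ^ 2 * d) * (maxNorm (hyperChow P) * ‖ω‖ ^ (m * d)) := by
    calc maxNorm ((maxMinor (Wmat ω) j₀ * C (ω j₀)⁻¹) ^ d) * (maxNorm P * ‖ω‖ ^ d)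
        ≤ (((m.factorial : ℝ) * ((m + 1) ^ m * ‖ω‖ ^ m)) ^ d / ‖ω‖ ^ d) *
            (((m + 1 : ℝ) ^ (m * d) * maxNorm (hyperChow P)) * ‖ω‖ ^ d) :=
          mul_le_mul hlamd (mul_le_mul_of_nonneg_right hPF (pow_nonneg (norm_nonneg _) _))
            (mul_nonneg (maxNorm_nonneg _) (pow_nonneg (norm_nonneg _) _))
            (div_nonneg (pow_nonneg (mul_nonneg (Nat.cast_nonneg _)
              (mul_nonneg (by positivity) (pow_nonneg (norm_nonneg _) _))) _)
              (pow_nonneg (norm_nonneg _) _))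
      _ = ((m.factorial : ℝ) * (m + 1) ^ m * (m + 1) ^ m) ^ d *
            (maxNorm (hyperChow P) * ‖ω‖ ^ (m * d)) := by
          have hω0 : ‖ω‖ ≠ 0 := hωpos.ne'
          field_simp
          ring
      _ ≤ Real.exp (2 * (m : ℝ) ^ 2 * d) * (maxNorm (hyperChow P) * ‖ω‖ ^ (m * d)) :=
          mul_le_mul_of_nonneg_right (const_pow_le_exp m d)
            (mul_nonneg (maxNorm_nonneg _) (pow_nonneg (norm_nonneg _) _))
  rw [hiabs, hX, normAt, hP.totalDegree hP0]
  calc ‖aeval ω P‖ * maxNorm ((maxMinor (Wmat ω) j₀ * C (ω j₀)⁻¹) ^ d) /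
        (maxNorm (hyperChow P) * ‖ω‖ ^ (m * d))
      = ‖aeval ω P‖ * (maxNorm ((maxMinor (Wmat ω) j₀ * C (ω j₀)⁻¹) ^ d) /
          (maxNorm (hyperChow P) * ‖ω‖ ^ (m * d))) := mul_div_assoc _ _ _
    _ ≤ ‖aeval ω P‖ * (Real.exp (2 * (m : ℝ) ^ 2 * d) / (maxNorm P * ‖ω‖ ^ d)) := by
        refine mul_le_mul_of_nonneg_left ?_ (norm_nonneg _)
        rw [div_le_div_iff₀ (mul_pos hFpos (pow_pos hωpos _)) (mul_pos hPpos (pow_pos hωpos _))]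
        exact key
    _ = ‖aeval ω P‖ / (maxNorm P * ‖ω‖ ^ d) * Real.exp (2 * (m : ℝ) ^ 2 * d) := by ring

/-! ### Assembly -/

/-- **LNM 1752 Ch. 3 Proposition 4.8** (`K = ℚ`, `ν = 1`), discharging the named fact
`NesterenkoPhilippon2001_ch3_prop_4_8`. [cite: NesterenkoPhilippon2001, Ch. 3 Prop. 4.8
(p. 40)] -/
theorem NesterenkoPhilippon2001_ch3_prop_4_8_holds : NesterenkoPhilippon2001_ch3_prop_4_8 := by
  intro m P d hm hP0 hP hunm ω hω
  have hd : 0 < d := pos_of_span_ne_top hP0 hP hunm.1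
  exact ⟨ideg_span_singleton hm hP0 hP hd, iheight_span_singleton_le hP0 hP hd,
    iabs_span_singleton_le hm hP0 hP hd hω⟩

end Nesterenko

end Literature.NumberTheory.Transcendental

end
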